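import Mathlib
import HarnessLib

/-!
# Route NewtonUnitEquations — crux `TwoProducts` (stmt-ValiantsHypothesis-5906), line `formal-log-linearisation`:
# the BOX LEMMA for the lifted log-sum engine (theory lane on the OPEN stub 5 `stub_logSumEngine`)

Registered line `Cruxes/TwoProducts/Lines/formal-log-linearisation.lean` (NOT the item's skeleton of record; helper
mode `--supports stmt-ValiantsHypothesis-5906 --as helper`, no stub credit claimed).  Context: the line's OPEN engine
`LogSumEngine` counts weight-visible points of the support of `D = Σ_j log(1+u_j) − Σ_j log(1+v_j)`; on a common
support `E = {e_1,…,e_s}` of the tails (`u_j = Σ_i A_{ji} X^{e_i}`, `v_j = Σ_i B_{ji} X^{e_i}`) its coefficients are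
fibre sums, with nonzero multinomial weights, of the UNEQUAL-MOMENT FUNCTION of the two `m`-point configurations
`A, B ⊂ ℂ^s`,

  `G(μ) = Σ_j A_j^μ − Σ_j B_j^μ`   (`A_j^μ = ∏_i A_{ji}^{μ_i}`),

and a valid planar weight becomes a strictly positive lifted grading `θ ∈ ℝ^s_{>0}` (memo `memo-logSumEngine-core.md`,
evidence #45 on the item: the LIFTED PENCIL COUNT of `θ`-minimal points of `{G ≠ 0}` is a NECESSARY condition for the
engine).  This file proves the first structural fact about those minimal points, over Mathlib only (no line
vocabulary, no definitions: `G` and the general signed exponential sum are written inline):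

* `ExpSum.prod_pow_update`, `ExpSum.wsum_update` — bookkeeping for changing one exponent;
* `ExpSum.minimal_lt_card` — **BOX LEMMA, general form**: for a signed exponential sum
  `F(ν) = Σ_{k ∈ κ} c_k ∏_i a_{ki}^{ν_i}` with finitely many terms and a strictly positive grading `θ`, every
  `θ`-MINIMAL point `μ` of `{F ≠ 0}` (i.e. `F(μ) ≠ 0` and `F(ν) = 0` whenever `⟨θ,ν⟩ < ⟨θ,μ⟩`) has `μ_i < |κ|` for
  every coordinate `i` — because in coordinate `i` all terms satisfy the common linear recurrence with characteristic
  polynomial `∏_k (T − a_{ki})` of degree `|κ|`, which expresses `F(μ)` through `F` at `|κ|` strictly `θ`-lighter points;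
* `unequalMoment_minimal_lt` — the engine's case `F = G`: `θ`-minimal unequal moments of two `m`-point configurations
  lie in the box `{0,…,2m−1}^s`; `unequalMoment_pencilVisible_lt` — the same under the pencil-visibility clause of the
  memo's `LiftedPencilCount` signature, verbatim.

Consequences recorded in the memo (not formalised here): the lifted count is trivial when `(2m)^s ≤ 2^{am}`, so its
content is the regime `s ≫ m / log m`; for `s = 2` it gives the Disproof-F4 bound `2m` without a rank argument.

## The statement this lemma serves (memo §2; recorded here as TEXT, deliberately NOT declared)

LIFTED PENCIL COUNT — necessary for `LogSumEngine` (hence for the crux `TwoProducts`): for two `m`-point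
configurations `A, B` in `ℂ^s` and a 2-pencil of strictly positive gradings `θ₁ + c·θ₂` (`c > 0`), call `μ`
PENCIL-VISIBLE if `G(μ) ≠ 0` and `μ` is the strict `(θ₁ + c θ₂)`-minimiser of `{ν : G(ν) ≠ 0}` for some `c > 0`;
then the pencil-visible multi-indices number at most `2^(a·m)·(s+2)^b`, uniformly in `A, B, θ₁, θ₂`.  As a Lean
signature (Mathlib only; a future Defs/fact file may declare it — this file does not):

```
def LiftedPencilCount : Prop :=
  ∃ a b : ℕ, ∀ (m s : ℕ) (A B : Fin m → Fin s → ℂ) (θ₁ θ₂ : Fin s → ℝ),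
    (∀ i, 0 < θ₁ i) → (∀ i, 0 < θ₂ i) →
    ∀ S : Finset (Fin s → ℕ),
      (∀ μ ∈ S, (∑ j, ∏ i, A j i ^ μ i) ≠ (∑ j, ∏ i, B j i ^ μ i) ∧
        ∃ c : ℝ, 0 < c ∧ ∀ ν : Fin s → ℕ, ν ≠ μ →
          (∑ j, ∏ i, A j i ^ ν i) ≠ (∑ j, ∏ i, B j i ^ ν i) →
            ∑ i, (θ₁ i + c * θ₂ i) * (μ i : ℝ) < ∑ i, (θ₁ i + c * θ₂ i) * (ν i : ℝ)) →
      S.card ≤ 2 ^ (a * m) * (s + 2) ^ b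
```

Known edges: `s = 1` (one point), `s = 2` (`≤ 2m`, Disproof F4 / `EngineCommonConeRung`), `m = 1` (`≤ s`); smallest open
instance `m = 2`, `s → ∞`; the hypothesis of `unequalMoment_pencilVisible_lt` below is this visibility clause verbatim.
Honest framing: an elementary structural lemma for the THEORY lane of an OPEN engine; the engine `stub_logSumEngine`
and the crux `TwoProducts` stay OPEN, the line is not the item's skeleton of record, and nothing here is progress on
`VP ≠ VNP` (NOT proved). No definitions, no named facts.
-/

noncomputable section

-- Sub = Summit single-conjunct layout: the duplicated namespace component is mandated by the tree.
set_option linter.dupNamespace false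

namespace Summit.ValiantsHypothesis.ValiantsHypothesis.Theorems.NewtonUnitEquations.TwoProducts.FormalLogLinearisation

open scoped BigOperators
open Polynomial

namespace ExpSum

variable {s : ℕ}

/-- Changing one exponent: `∏_{i'} a_{i'}^{(μ[i ↦ e])_{i'}} = a_i^e · ∏_{i' ≠ i} a_{i'}^{μ_{i'}}`. [folklore] -/
theorem prod_pow_update (a : Fin s → ℂ) (μ : Fin s → ℕ) (i : Fin s) (e : ℕ) :
    ∏ i', a i' ^ (Function.update μ i e) i' = a i ^ e * ∏ i' ∈ Finset.univ.erase i, a i' ^ μ i' := by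
  classical
  rw [← Finset.mul_prod_erase Finset.univ _ (Finset.mem_univ i), Function.update_self]
  congr 1
  refine Finset.prod_congr rfl fun i' hi' => ?_
  rw [Function.update_of_ne (Finset.ne_of_mem_erase hi')]

/-- The unchanged point: `∏_{i'} a_{i'}^{μ_{i'}} = a_i^{μ_i} · ∏_{i' ≠ i} a_{i'}^{μ_{i'}}`. [folklore] -/
theorem prod_pow_split (a : Fin s → ℂ) (μ : Fin s → ℕ) (i : Fin s) :
    ∏ i', a i' ^ μ i' = a i ^ μ i * ∏ i' ∈ Finset.univ.erase i, a i' ^ μ i' := by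
  classical
  rw [← Finset.mul_prod_erase Finset.univ _ (Finset.mem_univ i)]

/-- Weight of a point with one exponent changed: `⟨θ, μ[i ↦ e]⟩ = ⟨θ, μ⟩ − θ_i μ_i + θ_i e`. [folklore] -/
theorem wsum_update (θ : Fin s → ℝ) (μ : Fin s → ℕ) (i : Fin s) (e : ℕ) :
    ∑ i', θ i' * ((Function.update μ i e) i' : ℝ) =
      ∑ i', θ i' * (μ i' : ℝ) - θ i * (μ i : ℝ) + θ i * (e : ℝ) := by
  classical
  rw [← Finset.add_sum_erase Finset.univ _ (Finset.mem_univ i),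
    ← Finset.add_sum_erase Finset.univ (fun i' => θ i' * (μ i' : ℝ)) (Finset.mem_univ i), Function.update_self]
  have : ∑ i' ∈ Finset.univ.erase i, θ i' * ((Function.update μ i e) i' : ℝ) =
      ∑ i' ∈ Finset.univ.erase i, θ i' * (μ i' : ℝ) :=
    Finset.sum_congr rfl fun i' hi' => by rw [Function.update_of_ne (Finset.ne_of_mem_erase hi')]
  rw [this]
  ring

/-- **BOX LEMMA (general signed exponential sum).**  Let `F(ν) = Σ_{k} c_k ∏_i a_{ki}^{ν_i}` be a finite signed sum
of monomial characters on `ℕ^s` (index type `κ`) and `θ` a strictly positive grading.  If `μ` is `θ`-minimal in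
`{F ≠ 0}` — `F(μ) ≠ 0` and `F(ν) = 0` for every `ν` of strictly smaller `θ`-weight — then `μ_i < |κ|` for every `i`.
Proof: with `χ(T) = ∏_k (T − a_{ki}) = Σ_l d_l T^l` (monic, degree `n = |κ|`), each `a_{ki}` is a root, so for
`μ_i ≥ n`: `Σ_l d_l F(μ − (n−l)e_i) = Σ_k c_k (∏_{i'≠i} a_{ki'}^{μ_{i'}}) a_{ki}^{μ_i−n} χ(a_{ki}) = 0`; the points
`μ − (n−l)e_i`, `l < n`, are strictly `θ`-lighter, so all terms but `d_n F(μ) = F(μ)` vanish. [folklore] -/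
theorem minimal_lt_card {κ : Type*} [Fintype κ] (c : κ → ℂ) (a : κ → Fin s → ℂ) (θ : Fin s → ℝ)
    (hθ : ∀ i, 0 < θ i) (μ : Fin s → ℕ)
    (hμ : ∑ k, c k * ∏ i, a k i ^ μ i ≠ 0)
    (hmin : ∀ ν : Fin s → ℕ, ∑ i, θ i * (ν i : ℝ) < ∑ i, θ i * (μ i : ℝ) →
      ∑ k, c k * ∏ i, a k i ^ ν i = 0) :
    ∀ i, μ i < Fintype.card κ := by
  classical
  intro i
  by_contra hge
  push Not at hge
  set n := Fintype.card κ with hn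
  -- the signed exponential sum and the shifted points `ν l = μ − (n − l) e_i`
  set F : (Fin s → ℕ) → ℂ := fun ν => ∑ k, c k * ∏ i', a k i' ^ ν i' with hF
  set ν : ℕ → (Fin s → ℕ) := fun l => Function.update μ i (μ i - (n - l)) with hν
  -- the characteristic polynomial of coordinate `i`
  set χ : ℂ[X] := ∏ k, (X - C (a k i)) with hχ
  have hχmonic : χ.Monic := monic_prod_of_monic _ _ fun k _ => monic_X_sub_C (a k i)
  have hχdeg : χ.natDegree = n := by
    rw [hχ, natDegree_prod_of_monic _ _ fun k _ => monic_X_sub_C (a k i)]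
    simp [hn]
  have hχroot : ∀ k, χ.eval (a k i) = 0 := fun k => by
    rw [hχ, eval_prod]
    exact Finset.prod_eq_zero (Finset.mem_univ k) (by simp)
  have hχtop : χ.coeff n = 1 := by rw [← hχdeg]; exact hχmonic.coeff_natDegree
  -- `χ(x) = Σ_{l ≤ n} d_l x^l`
  have hχsum : ∀ x : ℂ, χ.eval x = ∑ l ∈ Finset.range (n + 1), χ.coeff l * x ^ l := fun x =>
    eval_eq_sum_range' (by rw [hχdeg]; exact Nat.lt_succ_self n) x
  -- the recurrence: `Σ_l d_l F(ν l) = 0`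
  have hrec : ∑ l ∈ Finset.range (n + 1), χ.coeff l * F (ν l) = 0 := by
    have hterm : ∀ l ∈ Finset.range (n + 1), χ.coeff l * F (ν l) =
        ∑ k, c k * (∏ i' ∈ Finset.univ.erase i, a k i' ^ μ i') * a k i ^ (μ i - n) *
          (χ.coeff l * a k i ^ l) := by
      intro l hl
      have hl' : l ≤ n := Nat.lt_succ_iff.mp (Finset.mem_range.mp hl)
      simp only [hF, hν, Finset.mul_sum]
      refine Finset.sum_congr rfl fun k _ => ?_
      rw [prod_pow_update]
      have hexp : μ i - (n - l) = (μ i - n) + l := by omega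
      rw [hexp, pow_add]
      ring
    rw [Finset.sum_congr rfl hterm, Finset.sum_comm]
    refine Finset.sum_eq_zero fun k _ => ?_
    rw [← Finset.mul_sum, ← hχsum (a k i), hχroot k, mul_zero]
  -- all terms with `l < n` vanish by minimality; the term `l = n` is `F μ`
  rw [Finset.sum_range_succ, hχtop, one_mul] at hrec
  have hlow : ∑ l ∈ Finset.range n, χ.coeff l * F (ν l) = 0 := by
    refine Finset.sum_eq_zero fun l hl => ?_
    have hl' : l < n := Finset.mem_range.mp hl
    have hlt : ∑ i', θ i' * ((ν l) i' : ℝ) < ∑ i', θ i' * (μ i' : ℝ) := by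
      simp only [hν]
      rw [wsum_update]
      have hcast : (((μ i - (n - l) : ℕ)) : ℝ) = (μ i : ℝ) - ((n : ℝ) - (l : ℝ)) := by
        rw [Nat.cast_sub (by omega), Nat.cast_sub hl'.le]
      rw [hcast]
      have hnl : (0 : ℝ) < (n : ℝ) - (l : ℝ) := by
        have : (l : ℝ) < (n : ℝ) := by exact_mod_cast hl'
        linarith
      nlinarith [hθ i]
    have := hmin (ν l) hlt
    simp only [hF] at this ⊢
    rw [this, mul_zero]
  have hνn : ν n = μ := by
    simp only [hν, Nat.sub_self, Nat.sub_zero]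
    exact Function.update_eq_self i μ
  rw [hlow, zero_add, hνn] at hrec
  exact hμ hrec

end ExpSum

/-- **BOX LEMMA for the lifted log-sum engine.**  For two `m`-point configurations `A, B` in `ℂ^s` and a strictly
positive grading `θ`, every `θ`-minimal point `μ` of `{G ≠ 0}`, `G(μ) = Σ_j A_j^μ − Σ_j B_j^μ` — `G(μ) ≠ 0` and
`G(ν) = 0` for all strictly `θ`-lighter `ν` — satisfies `μ_i < 2m` for every `i`: the θ-visible unequal moments lie in
the box `{0,…,2m−1}^s` (order-`2m` recurrence in each coordinate; `ExpSum.minimal_lt_card` with the `2m` signed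
terms `+A_j`, `−B_j`). [folklore] -/
theorem unequalMoment_minimal_lt {m s : ℕ} (A B : Fin m → Fin s → ℂ) (θ : Fin s → ℝ) (hθ : ∀ i, 0 < θ i)
    (μ : Fin s → ℕ) (hμ : (∑ j, ∏ i, A j i ^ μ i) ≠ (∑ j, ∏ i, B j i ^ μ i))
    (hmin : ∀ ν : Fin s → ℕ, ∑ i, θ i * (ν i : ℝ) < ∑ i, θ i * (μ i : ℝ) →
      (∑ j, ∏ i, A j i ^ ν i) = (∑ j, ∏ i, B j i ^ ν i)) :
    ∀ i, μ i < 2 * m := by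
  classical
  -- the `2m`-term signed exponential sum on `κ = Fin m ⊕ Fin m`
  let c : Fin m ⊕ Fin m → ℂ := Sum.elim (fun _ => 1) (fun _ => -1)
  let a : Fin m ⊕ Fin m → Fin s → ℂ := Sum.elim A B
  have hF : ∀ ν : Fin s → ℕ, ∑ k, c k * ∏ i, a k i ^ ν i =
      (∑ j, ∏ i, A j i ^ ν i) - (∑ j, ∏ i, B j i ^ ν i) := fun ν => by
    rw [Fintype.sum_sum_type]
    simp only [c, a, Sum.elim_inl, Sum.elim_inr, one_mul, neg_mul, Finset.sum_neg_distrib]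
    ring
  have hμ' : ∑ k, c k * ∏ i, a k i ^ μ i ≠ 0 := by rw [hF]; exact sub_ne_zero.mpr hμ
  have hmin' : ∀ ν : Fin s → ℕ, ∑ i, θ i * (ν i : ℝ) < ∑ i, θ i * (μ i : ℝ) →
      ∑ k, c k * ∏ i, a k i ^ ν i = 0 := fun ν hν => by rw [hF]; exact sub_eq_zero.mpr (hmin ν hν)
  have h := ExpSum.minimal_lt_card c a θ hθ μ hμ' hmin'
  intro i
  have hi := h i
  simp only [Fintype.card_sum, Fintype.card_fin] at hi
  omega

/-- **BOX LEMMA under the pencil-visibility clause** of the memo's `LiftedPencilCount` (verbatim hypothesis shape):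
if `G(μ) ≠ 0` and, for some `c > 0`, `μ` is the strict `(θ₁ + c·θ₂)`-minimiser of `{G ≠ 0}` (`θ₁, θ₂` strictly
positive), then `μ_i < 2m` for all `i`.  So pencil-visible unequal moments are a subset of the finite box
`{0,…,2m−1}^s`; in particular `LiftedPencilCount` is trivially true whenever `(2m)^s ≤ 2^(a·m)`. [folklore] -/
theorem unequalMoment_pencilVisible_lt {m s : ℕ} (A B : Fin m → Fin s → ℂ) (θ₁ θ₂ : Fin s → ℝ)
    (hθ₁ : ∀ i, 0 < θ₁ i) (hθ₂ : ∀ i, 0 < θ₂ i) (μ : Fin s → ℕ)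
    (hvis : (∑ j, ∏ i, A j i ^ μ i) ≠ (∑ j, ∏ i, B j i ^ μ i) ∧
      ∃ c : ℝ, 0 < c ∧ ∀ ν : Fin s → ℕ, ν ≠ μ →
        (∑ j, ∏ i, A j i ^ ν i) ≠ (∑ j, ∏ i, B j i ^ ν i) →
          ∑ i, (θ₁ i + c * θ₂ i) * (μ i : ℝ) < ∑ i, (θ₁ i + c * θ₂ i) * (ν i : ℝ)) :
    ∀ i, μ i < 2 * m := by
  obtain ⟨hμ, c, hc, hstrict⟩ := hvis
  refine unequalMoment_minimal_lt A B (fun i => θ₁ i + c * θ₂ i)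
    (fun i => by have := hθ₁ i; have := hθ₂ i; positivity) μ hμ fun ν hν => ?_
  by_contra hne
  have hνμ : ν ≠ μ := by
    rintro rfl
    exact lt_irrefl _ hν
  have := hstrict ν hνμ hne
  linarith

end Summit.ValiantsHypothesis.ValiantsHypothesis.Theorems.NewtonUnitEquations.TwoProducts.FormalLogLinearisation

end
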